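/-
COR-CM (cell pub-hodgecm2, stage 2 of the Hodge ladder) — count-neutral kernel combinatorics (seat prover-pub-hodgecm2-b23-g51-0, binder
prover b23, gen 51; lane SYLOW TRANSFER, claim HOME/INBOX.md l.23329; blanket `Census/SylowTransfer*` l.23357).  Pure group theory,
Mathlib only; theorems only (no definition, no certificate, no `decide`, no named fact, no `sorry`).
`Interfaces.lean` (C1), every E term, B01 and `Transposition/*` are untouched.
HONEST FRAMING: `HC_CM` is NOT proved, here or anywhere in the tree; nothing here is a period or a headline.
-/
import Summits.HodgeConjecture.CorCM.Census.SylowTransferComplement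
import Mathlib.FieldTheory.Finite.Basic

/-!
# Sylow transfer, V: the Sylow `2`-subgroup `ℤ/2ᵏ × ℤ/2` — normal form and Burnside's hypothesis `N_G(P) ≤ C_G(P)`

SETTING.  `P ≤ G` with `|P| = 2·ord u` containing commuting elements `u` (of order `2ᵏ` where stated) and an involution `x ∉ ⟨u⟩`; then
`P = ⟨u⟩ × ⟨x⟩ ≅ ℤ/2ᵏ × ℤ/2`.
* §1 **NORMAL FORM** (`exists_normalForm`): every `p ∈ P` is `uⁱ xʲ` (`i < ord u`, `j < 2`), uniquely (`normalForm_injOn`); `P` is abelian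
  (`comm_of_mem`); `(uⁱxʲ)² = u²ⁱ` (`normalForm_sq`); for `k ≥ 2` and `i` odd, `u² ∈ ⟨uⁱ xʲ⟩` and `u^{2^{k−1}} ∈ ⟨uⁱ xʲ⟩`
  (`sq_mem_zpowers_of_odd`, `pow_half_mem_zpowers_of_odd` — the ROOTS property used in part VI); involutions of `P` are `1, c₀, x, c₀x` with
  `c₀ = u^{2^{k−1}}` (`involution_eq`).
* §2 **BURNSIDE'S HYPOTHESIS** (`normalizer_le_centralizer`): if moreover `[G:P]` is odd (Sylow) and `k ≥ 2`, then `N_G(P) ≤ C_G(P)`.  Proof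
  without `Aut(P)`: for `g ∈ N_G(P)`, `g u g⁻¹ = uᵃ xᶠ` with `a` odd and `g x g⁻¹ ∈ {x, c₀x}` (`c₀` is fixed: `g c₀ g⁻¹ = (uᵃxᶠ)^{2^{k−1}} = c₀`);
  hence `g²` fixes `x` and acts on `u` by an odd power `b` (`conj_sq_u`), so `g^{2ᵏ} = (g²)^{2^{k−1}}` acts on `u` by `b^{2^{k−1}} ≡ 1 (mod 2ᵏ)`
  (Euler, `Nat.ModEq.pow_totient`): `g^{2ᵏ} ∈ C_G(P)`; and `g^{[N_G(P):P]} ∈ P ≤ C_G(P)` with `[N_G(P):P]` odd; Bézout.  This is the input of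
  Mathlib's `MonoidHom.transferSylow` (part VI).
All [folklore].

## References
* [Pohlmann1968] H. Pohlmann, Algebraic cycles on abelian varieties of complex multiplication type, Ann. of Math. 88 (1968), Thm 1.
* [Milne1999] J. S. Milne, Lefschetz motives and the Tate conjecture, Compositio Math. 117 (1999), Prop. 2.1, p. 54.
-/

namespace Summit.HodgeConjecture.CorCM.Census.SylowTransfer

open Finset

section NormalForm

variable {G : Type*} [Group G]

/-! ## §1 The normal form `uⁱ xʲ` -/

/-- If `uⁱ xʲ = uⁱ' xʲ'` with `j, j' < 2` and `x ∉ ⟨u⟩` an involution, then `j = j'`. [folklore] -/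
theorem snd_eq_of_normalForm_eq {u x : G} (hxu : x ∉ Subgroup.zpowers u) (hx2 : x * x = 1) {i i' j j' : ℕ} (hj : j < 2) (hj' : j' < 2)
    (h : u ^ i * x ^ j = u ^ i' * x ^ j') : j = j' := by
  by_contra hne
  apply hxu
  have hmem : x ^ j * (x ^ j')⁻¹ ∈ Subgroup.zpowers u := by
    have key : x ^ j * (x ^ j')⁻¹ = (u ^ i)⁻¹ * u ^ i' := by
      rw [eq_inv_mul_iff_mul_eq, ← mul_assoc, h, mul_inv_cancel_right]
    rw [key]
    exact mul_mem (inv_mem (Subgroup.pow_mem _ (Subgroup.mem_zpowers u) i)) (Subgroup.pow_mem _ (Subgroup.mem_zpowers u) i')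
  have hxinv : x⁻¹ = x := inv_eq_of_mul_eq_one_right hx2
  interval_cases j <;> interval_cases j'
  · exact absurd rfl hne
  · rwa [pow_zero, pow_one, one_mul, hxinv] at hmem
  · rwa [pow_one, pow_zero, inv_one, mul_one] at hmem
  · exact absurd rfl hne

/-- **Uniqueness of the normal form**: `(i, j) ↦ uⁱ xʲ` is injective on `i < ord u`, `j < 2` (`x ∉ ⟨u⟩` an involution). [folklore] -/
theorem normalForm_injOn {u x : G} (hxu : x ∉ Subgroup.zpowers u) (hx2 : x * x = 1) :
    Set.InjOn (fun ij : ℕ × ℕ => u ^ ij.1 * x ^ ij.2) ↑(range (orderOf u) ×ˢ range 2) := by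
  rintro ⟨i, j⟩ hij ⟨i', j'⟩ hij' h
  simp only [coe_product, coe_range, Set.mem_prod, Set.mem_Iio] at hij hij'
  have hjj : j = j' := snd_eq_of_normalForm_eq hxu hx2 hij.2 hij'.2 h
  subst hjj
  have hii : u ^ i = u ^ i' := mul_right_cancel h
  exact Prod.ext (pow_injOn_Iio_orderOf hij.1 hij'.1 hii) rfl

/-- **THE NORMAL FORM**: in a subgroup `P ∋ u, x` of order `2·ord u` with `x ∉ ⟨u⟩` an involution, every element is `uⁱ xʲ` (`i < ord u`,
`j < 2`). [folklore] -/
theorem exists_normalForm [Finite G] {P : Subgroup G} {u x : G} (hu : u ∈ P) (hx : x ∈ P) (hxu : x ∉ Subgroup.zpowers u) (hx2 : x * x = 1)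
    (hcard : Nat.card P = 2 * orderOf u) {p : G} (hp : p ∈ P) : ∃ i < orderOf u, ∃ j < 2, p = u ^ i * x ^ j := by
  classical
  set S : Finset G := (range (orderOf u) ×ˢ range 2).image fun ij : ℕ × ℕ => u ^ ij.1 * x ^ ij.2 with hS
  have hScard : S.card = 2 * orderOf u := by
    rw [hS, card_image_of_injOn (normalForm_injOn hxu hx2), card_product, card_range, card_range, mul_comm]
  have hSP : (↑S : Set G) ⊆ (P : Set G) := by
    intro q hq
    obtain ⟨⟨i, j⟩, -, rfl⟩ := mem_image.mp (mem_coe.mp hq)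
    exact mul_mem (P.pow_mem hu i) (P.pow_mem hx j)
  have hSeq : (↑S : Set G) = (P : Set G) :=
    Set.eq_of_subset_of_ncard_le hSP (by rw [Set.ncard_coe_finset, hScard, ← hcard]; rfl) (Set.toFinite _)
  have hpS : p ∈ S := by
    rw [← mem_coe, hSeq]
    exact hp
  obtain ⟨⟨i, j⟩, hij, hpij⟩ := mem_image.mp hpS
  rw [mem_product, mem_range, mem_range] at hij
  exact ⟨i, hij.1, j, hij.2, hpij.symm⟩

/-- Such a subgroup is **abelian**. [folklore] -/
theorem comm_of_mem [Finite G] {P : Subgroup G} {u x : G} (hu : u ∈ P) (hx : x ∈ P) (hxu : x ∉ Subgroup.zpowers u) (hx2 : x * x = 1)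
    (hux : u * x = x * u) (hcard : Nat.card P = 2 * orderOf u) {p : G} (hp : p ∈ P) {q : G} (hq : q ∈ P) : p * q = q * p := by
  obtain ⟨i, -, j, -, rfl⟩ := exists_normalForm hu hx hxu hx2 hcard hp
  obtain ⟨i', -, j', -, rfl⟩ := exists_normalForm hu hx hxu hx2 hcard hq
  have hc : Commute u x := hux
  have h1 : Commute (u ^ i * x ^ j) (u ^ i') := ((Commute.refl u).pow_pow i i').mul_left ((hc.symm).pow_pow j i')
  have h2 : Commute (u ^ i * x ^ j) (x ^ j') := (hc.pow_pow i j').mul_left ((Commute.refl x).pow_pow j j')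
  exact (h1.mul_right h2).eq

/-- `(uᵃ xᶠ)^n = u^{an} x^{fn}` for commuting `u, x`. [folklore] -/
theorem normalForm_pow {u x : G} (hux : u * x = x * u) (a f n : ℕ) : (u ^ a * x ^ f) ^ n = u ^ (a * n) * x ^ (f * n) := by
  rw [((show Commute u x from hux).pow_pow a f).mul_pow, ← pow_mul, ← pow_mul]

/-- `x^{f n} = 1` for an involution `x` and `n` even (seat b04ʼs `GaloisModels.CyclicEight.invol_pow_even` is the case `f = 1`; restated in
product form to keep this file Mathlib-only). [folklore] -/
theorem pow_mul_eq_one_of_even {x : G} (hx2 : x * x = 1) (f : ℕ) {n : ℕ} (hn : Even n) : x ^ (f * n) = 1 := by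
  obtain ⟨r, hr⟩ := hn.mul_left f
  rw [hr, pow_add, ← (Commute.refl x).mul_pow, hx2, one_pow]

/-- `(uⁱ xʲ)² = u^{2i}`. [folklore] -/
theorem normalForm_sq {u x : G} (hx2 : x * x = 1) (hux : u * x = x * u) (i j : ℕ) : (u ^ i * x ^ j) ^ 2 = u ^ (2 * i) := by
  rw [normalForm_pow hux, pow_mul_eq_one_of_even hx2 j even_two, mul_one, mul_comm]

/-- **ROOTS, I**: for `i` odd (and `ord u = 2ᵏ`, `k ≥ 1`), `u² ∈ ⟨uⁱ xʲ⟩`. [folklore] -/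
theorem sq_mem_zpowers_of_odd {u x : G} {k : ℕ} (hord : orderOf u = 2 ^ k) (hk : 1 ≤ k) (hx2 : x * x = 1) (hux : u * x = x * u)
    {i : ℕ} (hi : Odd i) (j : ℕ) : u ^ 2 ∈ Subgroup.zpowers (u ^ i * x ^ j) := by
  have h1 : 1 < 2 ^ k := Nat.one_lt_two_pow (by omega)
  have hcop : Nat.Coprime i (2 ^ k) := Nat.Coprime.pow_right _ (Nat.coprime_two_right.mpr hi)
  obtain ⟨i', -, hi'⟩ := Nat.exists_mul_mod_eq_one_of_coprime hcop h1
  obtain ⟨q, hq⟩ : ∃ q, i * i' = 2 ^ k * q + 1 := ⟨i * i' / 2 ^ k, by rw [← hi', Nat.div_add_mod]⟩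
  refine Subgroup.mem_zpowers_iff.mpr ⟨((2 * i' : ℕ) : ℤ), ?_⟩
  rw [zpow_natCast, pow_mul, normalForm_sq hx2 hux, ← pow_mul, pow_inj_mod, hord,
    show 2 * i * i' = 2 ^ k * (2 * q) + 2 by rw [mul_assoc, hq]; ring, Nat.mul_add_mod]

/-- **ROOTS, II**: for `k ≥ 2` and `i` odd, `c₀ = u^{2^{k−1}} ∈ ⟨uⁱ xʲ⟩`. [folklore] -/
theorem pow_half_mem_zpowers_of_odd {u x : G} {k : ℕ} (hord : orderOf u = 2 ^ k) (hk : 2 ≤ k) (hx2 : x * x = 1) (hux : u * x = x * u)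
    {i : ℕ} (hi : Odd i) (j : ℕ) : u ^ 2 ^ (k - 1) ∈ Subgroup.zpowers (u ^ i * x ^ j) := by
  have h := Subgroup.pow_mem _ (sq_mem_zpowers_of_odd hord (by omega) hx2 hux hi j) (2 ^ (k - 2))
  rwa [← pow_mul, show 2 * 2 ^ (k - 2) = 2 ^ (k - 1) by rw [← pow_succ']; congr 1; omega] at h

/-- An odd power of `u` raised to `2^{k−1}` is `c₀ = u^{2^{k−1}}` (`ord u = 2ᵏ`). [folklore] -/
theorem pow_half_of_odd {u : G} {k : ℕ} (hord : orderOf u = 2 ^ k) (hk : 1 ≤ k) {a : ℕ} (ha : Odd a) :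
    u ^ (a * 2 ^ (k - 1)) = u ^ 2 ^ (k - 1) := by
  obtain ⟨m, rfl⟩ := ha
  have h2k : 2 ^ k = 2 * 2 ^ (k - 1) := by rw [← pow_succ']; congr 1; omega
  rw [pow_inj_mod, hord, show (2 * m + 1) * 2 ^ (k - 1) = 2 ^ k * m + 2 ^ (k - 1) by rw [h2k]; ring, Nat.mul_add_mod]

/-- An even multiple of `2^{k−1}` kills `u` (`ord u = 2ᵏ`). [folklore] -/
theorem pow_half_of_even {u : G} {k : ℕ} (hord : orderOf u = 2 ^ k) (hk : 1 ≤ k) {a : ℕ} (ha : Even a) : u ^ (a * 2 ^ (k - 1)) = 1 := by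
  obtain ⟨m, rfl⟩ := ha
  have h2k : 2 ^ k = 2 * 2 ^ (k - 1) := by rw [← pow_succ']; congr 1; omega
  rw [show (m + m) * 2 ^ (k - 1) = 2 ^ k * m by rw [h2k]; ring, pow_mul, ← hord, pow_orderOf_eq_one, one_pow]

/-- **The involutions of `P`**: an element `uⁱ xʲ` (`i < 2ᵏ`) of square `1` has `i ∈ {0, 2^{k−1}}`. [folklore] -/
theorem fst_eq_of_sq_eq_one {u x : G} {k : ℕ} (hord : orderOf u = 2 ^ k) (hk : 1 ≤ k) (hx2 : x * x = 1) (hux : u * x = x * u)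
    {i j : ℕ} (hi : i < 2 ^ k) (h : (u ^ i * x ^ j) ^ 2 = 1) : i = 0 ∨ i = 2 ^ (k - 1) := by
  rw [normalForm_sq hx2 hux, ← orderOf_dvd_iff_pow_eq_one, hord] at h
  have h2k : 2 ^ k = 2 * 2 ^ (k - 1) := by rw [← pow_succ']; congr 1; omega
  rw [h2k] at h hi
  have h' : 2 ^ (k - 1) ∣ i := Nat.dvd_of_mul_dvd_mul_left two_pos h
  obtain ⟨m, rfl⟩ := h'
  have hm : m < 2 := by
    by_contra hm
    have : 2 * 2 ^ (k - 1) ≤ 2 ^ (k - 1) * m := by nlinarith [Nat.one_le_two_pow (n := k - 1)]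
    omega
  interval_cases m <;> simp

end NormalForm

section Burnside

variable {G : Type*} [Group G]

/-! ## §2 Burnside's hypothesis for a Sylow `ℤ/2ᵏ × ℤ/2` -/

/-- Conjugation iterates: `h u h⁻¹ = uᵇ` ⟹ `hⁿ u h⁻ⁿ = u^{bⁿ}`. [folklore] -/
theorem conj_pow_of_conj_eq {h u : G} {b : ℕ} (hh : h * u * h⁻¹ = u ^ b) (n : ℕ) : h ^ n * u * (h ^ n)⁻¹ = u ^ b ^ n := by
  induction n with
  | zero => rw [pow_zero, pow_zero, one_mul, inv_one, mul_one, pow_one]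
  | succ n ih =>
    have e1 : h ^ (n + 1) * u * (h ^ (n + 1))⁻¹ = h * (h ^ n * u * (h ^ n)⁻¹) * h⁻¹ := by
      rw [pow_succ', mul_inv_rev]; group
    rw [e1, ih, ← MulAut.conj_apply, map_pow, MulAut.conj_apply, hh, ← pow_mul, pow_succ']

/-- Conjugation fixes: `h x h⁻¹ = x` ⟹ `hⁿ x h⁻ⁿ = x`. [folklore] -/
theorem conj_pow_of_conj_eq_self {h x : G} (hh : h * x * h⁻¹ = x) (n : ℕ) : h ^ n * x * (h ^ n)⁻¹ = x := by
  have hh' : h * x * h⁻¹ = x ^ 1 := by rw [pow_one]; exact hh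
  have key := conj_pow_of_conj_eq hh' n
  rwa [one_pow, pow_one] at key

/-- Membership from coprime powers: `gᵐ, gⁿ ∈ H` with `m, n` coprime ⟹ `g ∈ H` (Bézout). [folklore] -/
theorem mem_of_pow_mem_of_coprime {H : Subgroup G} {g : G} {m n : ℕ} (hmn : Nat.Coprime m n) (hm : g ^ m ∈ H) (hn : g ^ n ∈ H) :
    g ∈ H := by
  have key : g ^ ((m : ℤ) * Nat.gcdA m n + (n : ℤ) * Nat.gcdB m n) ∈ H := by
    rw [zpow_add, zpow_mul, zpow_mul, zpow_natCast, zpow_natCast]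
    exact mul_mem (Subgroup.zpow_mem _ hm _) (Subgroup.zpow_mem _ hn _)
  rwa [← Nat.gcd_eq_gcd_ab, Nat.Coprime.gcd_eq_one hmn, Nat.cast_one, zpow_one] at key

/-- **The conjugate of `u` by `g ∈ N_G(P)`** is `uᵃ xᶠ` with `a` odd (`ord u = 2ᵏ`, `k ≥ 1`). [folklore] -/
theorem conj_u_normalForm [Finite G] {P : Subgroup G} {u x : G} {k : ℕ} (hu : u ∈ P) (hx : x ∈ P) (hxu : x ∉ Subgroup.zpowers u)
    (hx2 : x * x = 1) (hux : u * x = x * u) (hord : orderOf u = 2 ^ k) (hk : 2 ≤ k) (hcard : Nat.card P = 2 * orderOf u)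
    {g : G} (hg : g ∈ Subgroup.normalizer (P : Set G)) : ∃ a f : ℕ, Odd a ∧ f < 2 ∧ g * u * g⁻¹ = u ^ a * x ^ f := by
  have hgu : g * u * g⁻¹ ∈ P := (Subgroup.mem_normalizer_iff.mp hg u).mp hu
  obtain ⟨a, -, f, hf, haf⟩ := exists_normalForm hu hx hxu hx2 hcard hgu
  refine ⟨a, f, ?_, hf, haf⟩
  -- `a` even would force `ord (g u g⁻¹) ∣ 2^{k-1}`
  by_contra ha
  rw [Nat.not_odd_iff_even] at ha
  have hordc : orderOf (g * u * g⁻¹) = 2 ^ k := by rw [← MulAut.conj_apply, MulEquiv.orderOf_eq, hord]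
  have h1 : (g * u * g⁻¹) ^ 2 ^ (k - 1) = 1 := by
    rw [haf, normalForm_pow hux, pow_half_of_even hord (by omega) ha, one_mul]
    exact pow_mul_eq_one_of_even hx2 f (by rw [Nat.even_pow]; exact ⟨even_two, by omega⟩)
  have hdvd := orderOf_dvd_of_pow_eq_one h1
  rw [hordc, Nat.pow_dvd_pow_iff_le_right one_lt_two] at hdvd
  omega

/-- **`g ∈ N_G(P)` fixes `c₀ = u^{2^{k−1}}`**. [folklore] -/
theorem conj_pow_half [Finite G] {P : Subgroup G} {u x : G} {k : ℕ} (hu : u ∈ P) (hx : x ∈ P) (hxu : x ∉ Subgroup.zpowers u)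
    (hx2 : x * x = 1) (hux : u * x = x * u) (hord : orderOf u = 2 ^ k) (hk : 2 ≤ k) (hcard : Nat.card P = 2 * orderOf u)
    {g : G} (hg : g ∈ Subgroup.normalizer (P : Set G)) : g * u ^ 2 ^ (k - 1) * g⁻¹ = u ^ 2 ^ (k - 1) := by
  obtain ⟨a, f, ha, -, haf⟩ := conj_u_normalForm hu hx hxu hx2 hux hord hk hcard hg
  rw [← MulAut.conj_apply, map_pow, MulAut.conj_apply, haf, normalForm_pow hux, pow_half_of_odd hord (by omega) ha,
    pow_mul_eq_one_of_even hx2 f (by rw [Nat.even_pow]; exact ⟨even_two, by omega⟩), mul_one]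

/-- **The conjugate of `x` by `g ∈ N_G(P)`** is `x` or `c₀ x`: `g x g⁻¹ = u^e x` with `e ∈ {0, 2^{k−1}}` (`k ≥ 2`). [folklore] -/
theorem conj_x_normalForm [Finite G] {P : Subgroup G} {u x : G} {k : ℕ} (hu : u ∈ P) (hx : x ∈ P) (hxu : x ∉ Subgroup.zpowers u)
    (hx2 : x * x = 1) (hx1 : x ≠ 1) (hux : u * x = x * u) (hord : orderOf u = 2 ^ k) (hk : 2 ≤ k) (hcard : Nat.card P = 2 * orderOf u)
    {g : G} (hg : g ∈ Subgroup.normalizer (P : Set G)) : ∃ e : ℕ, (e = 0 ∨ e = 2 ^ (k - 1)) ∧ g * x * g⁻¹ = u ^ e * x := by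
  have hgx : g * x * g⁻¹ ∈ P := (Subgroup.mem_normalizer_iff.mp hg x).mp hx
  obtain ⟨e, he, j, hj, hej⟩ := exists_normalForm hu hx hxu hx2 hcard hgx
  rw [hord] at he
  have hsq : (u ^ e * x ^ j) ^ 2 = 1 := by
    rw [← hej, ← MulAut.conj_apply, ← map_pow, pow_two, hx2, map_one]
  have he' := fst_eq_of_sq_eq_one hord (by omega) hx2 hux he hsq
  refine ⟨e, he', ?_⟩
  interval_cases j
  · -- `j = 0`: `g x g⁻¹ = u^e ∈ {1, c₀}` — impossible (`x ≠ 1`; `c₀` is fixed by `g` and `x ≠ c₀`)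
    exfalso
    rw [pow_zero, mul_one] at hej
    rcases he' with rfl | rfl
    · rw [pow_zero, ← MulAut.conj_apply, map_eq_one_iff _ (MulAut.conj g).injective] at hej
      exact hx1 hej
    · have h2 : g * x * g⁻¹ = g * u ^ 2 ^ (k - 1) * g⁻¹ := by rw [hej, conj_pow_half hu hx hxu hx2 hux hord hk hcard hg]
      have h3 : x = u ^ 2 ^ (k - 1) := by
        rw [← MulAut.conj_apply, ← MulAut.conj_apply] at h2
        exact (MulAut.conj g).injective h2
      exact hxu (h3 ▸ Subgroup.pow_mem _ (Subgroup.mem_zpowers u) _)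
  · rw [hej, pow_one]

/-- `(uⁱ xʲ)(uⁱ' xʲ') = u^{i+i'} x^{j+j'}` for commuting `u, x`. [folklore] -/
theorem normalForm_mul {u x : G} (hux : u * x = x * u) (i j i' j' : ℕ) :
    (u ^ i * x ^ j) * (u ^ i' * x ^ j') = u ^ (i + i') * x ^ (j + j') := by
  have hc : Commute (x ^ j) (u ^ i') := ((show Commute u x from hux).pow_pow i' j).symm
  rw [mul_assoc, ← mul_assoc (x ^ j), hc.eq, mul_assoc, ← pow_add, ← mul_assoc, ← pow_add]

/-- **`g²` acts on `u` by an odd power and fixes `x`** (`g ∈ N_G(P)`, `k ≥ 2`). [folklore] -/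
theorem conj_sq [Finite G] {P : Subgroup G} {u x : G} {k : ℕ} (hu : u ∈ P) (hx : x ∈ P) (hxu : x ∉ Subgroup.zpowers u)
    (hx2 : x * x = 1) (hx1 : x ≠ 1) (hux : u * x = x * u) (hord : orderOf u = 2 ^ k) (hk : 2 ≤ k) (hcard : Nat.card P = 2 * orderOf u)
    {g : G} (hg : g ∈ Subgroup.normalizer (P : Set G)) : (∃ b : ℕ, Odd b ∧ (g * g) * u * (g * g)⁻¹ = u ^ b) ∧ (g * g) * x * (g * g)⁻¹ = x := by
  obtain ⟨a, f, ha, -, haf⟩ := conj_u_normalForm hu hx hxu hx2 hux hord hk hcard hg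
  obtain ⟨e, he, hex⟩ := conj_x_normalForm hu hx hxu hx2 hx1 hux hord hk hcard hg
  have heven : Even e := by
    rcases he with rfl | rfl
    · exact ⟨0, rfl⟩
    · rw [Nat.even_pow]; exact ⟨even_two, by omega⟩
  have hue : u ^ (2 * e) = 1 := by
    rcases he with rfl | rfl
    · rw [mul_zero, pow_zero]
    · rw [show 2 * 2 ^ (k - 1) = 2 ^ k by rw [← pow_succ']; congr 1; omega, ← hord, pow_orderOf_eq_one]
  have hφu : MulAut.conj g u = u ^ a * x ^ f := by rw [MulAut.conj_apply, haf]
  have hφx : MulAut.conj g x = u ^ e * x ^ 1 := by rw [MulAut.conj_apply, hex, pow_one]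
  have hgg : ∀ y : G, (g * g) * y * (g * g)⁻¹ = MulAut.conj g (MulAut.conj g y) := fun y => by
    rw [← MulAut.mul_apply, ← map_mul, MulAut.conj_apply]
  constructor
  · refine ⟨a * a + e * f, ?_, ?_⟩
    · exact (ha.mul ha).add_even (heven.mul_right f)
    · rw [hgg, hφu, map_mul, map_pow, map_pow, hφu, hφx, normalForm_pow hux, normalForm_pow hux, normalForm_mul hux,
        show f * a + 1 * f = f * (a + 1) by ring, pow_mul_eq_one_of_even hx2 f ha.add_one, mul_one]
  · obtain ⟨m, hm⟩ := ha
    rw [hgg, hφx, map_mul, map_pow, map_pow, hφu, hφx, normalForm_pow hux, normalForm_pow hux, normalForm_mul hux,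
      show a * e + e * 1 = (2 * e) * (m + 1) by rw [hm]; ring, pow_mul, hue, one_pow, one_mul,
      show f * e + 1 * 1 = f * e + 1 by ring, pow_add, pow_one, pow_mul_eq_one_of_even hx2 f heven, one_mul]

/-- **BURNSIDE'S HYPOTHESIS `N_G(P) ≤ C_G(P)` for `P = ⟨u⟩ × ⟨x⟩ ≅ ℤ/2ᵏ × ℤ/2` (`k ≥ 2`) of odd index.** [folklore] -/
theorem normalizer_le_centralizer [Finite G] {P : Subgroup G} {u x : G} {k : ℕ} (hu : u ∈ P) (hx : x ∈ P) (hxu : x ∉ Subgroup.zpowers u)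
    (hx2 : x * x = 1) (hx1 : x ≠ 1) (hux : u * x = x * u) (hord : orderOf u = 2 ^ k) (hk : 2 ≤ k) (hcard : Nat.card P = 2 * orderOf u)
    (hodd : Odd P.index) : Subgroup.normalizer (P : Set G) ≤ Subgroup.centralizer (P : Set G) := by
  intro g hg
  have h1lt : 1 < 2 ^ k := Nat.one_lt_two_pow (by omega)
  have h2k : 2 * 2 ^ (k - 1) = 2 ^ k := by rw [← pow_succ']; congr 1; omega
  -- (1) `g^(2^k)` centralises `u` and `x`
  obtain ⟨⟨b, hb, hbu⟩, hgx⟩ := conj_sq hu hx hxu hx2 hx1 hux hord hk hcard hg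
  have hcop : Nat.Coprime b (2 ^ k) := Nat.Coprime.pow_right _ (Nat.coprime_two_right.mpr hb)
  have heuler : b ^ 2 ^ (k - 1) % 2 ^ k = 1 % 2 ^ k := by
    have h := Nat.ModEq.pow_totient hcop
    rwa [Nat.totient_prime_pow Nat.prime_two (by omega), show 2 - 1 = 1 from rfl, mul_one] at h
  have e1 : g ^ 2 ^ k = (g * g) ^ 2 ^ (k - 1) := by rw [← pow_two, ← pow_mul, h2k]
  have hu' : g ^ 2 ^ k * u * (g ^ 2 ^ k)⁻¹ = u := by
    rw [e1, conj_pow_of_conj_eq hbu]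
    conv_rhs => rw [← pow_one u]
    rw [pow_inj_mod, hord, heuler]
  have hx' : g ^ 2 ^ k * x * (g ^ 2 ^ k)⁻¹ = x := by
    rw [e1]
    exact conj_pow_of_conj_eq_self hgx _
  -- (2) `g^q ∈ P` for the odd number `q = [N_G(P) : P]`
  have hq : g ^ (P.relIndex (Subgroup.normalizer (P : Set G))) ∈ P := by
    have h := Subgroup.pow_index_mem (P.subgroupOf (Subgroup.normalizer (P : Set G))) ⟨g, hg⟩
    rw [Subgroup.mem_subgroupOf, SubmonoidClass.coe_pow] at h
    exact h
  have hqodd : Odd (P.relIndex (Subgroup.normalizer (P : Set G))) :=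
    hodd.of_dvd_nat (Subgroup.relIndex_dvd_index_of_le Subgroup.le_normalizer)
  -- (3) Bézout
  refine mem_of_pow_mem_of_coprime (Nat.Coprime.pow_right k (Nat.coprime_two_right.mpr hqodd)) ?_ ?_
  · exact Subgroup.mem_centralizer_iff.mpr fun p hp => comm_of_mem hu hx hxu hx2 hux hcard hp hq
  · refine Subgroup.mem_centralizer_iff.mpr fun p hp => ?_
    obtain ⟨i, -, j, -, rfl⟩ := exists_normalForm hu hx hxu hx2 hcard hp
    have hcu : Commute (g ^ 2 ^ k) u := mul_inv_eq_iff_eq_mul.mp hu'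
    have hcx : Commute (g ^ 2 ^ k) x := mul_inv_eq_iff_eq_mul.mp hx'
    exact ((hcu.pow_right i).mul_right (hcx.pow_right j)).symm.eq

/-- **Sylow form**: for a Sylow `2`-subgroup `P = ⟨u⟩ × ⟨x⟩ ≅ ℤ/2ᵏ × ℤ/2` (`k ≥ 2`), `N_G(P) ≤ C_G(P)`. [folklore] -/
theorem normalizer_le_centralizer_sylow [Finite G] (P : Sylow 2 G) {u x : G} {k : ℕ} (hu : u ∈ (P : Subgroup G))
    (hx : x ∈ (P : Subgroup G)) (hxu : x ∉ Subgroup.zpowers u) (hx2 : x * x = 1) (hx1 : x ≠ 1) (hux : u * x = x * u)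
    (hord : orderOf u = 2 ^ k) (hk : 2 ≤ k) (hcard : Nat.card (P : Subgroup G) = 2 * orderOf u) :
    Subgroup.normalizer (P : Set G) ≤ Subgroup.centralizer (P : Set G) := by
  haveI : Fact (Nat.Prime 2) := ⟨Nat.prime_two⟩
  exact normalizer_le_centralizer hu hx hxu hx2 hx1 hux hord hk hcard (Nat.odd_iff.mpr (Nat.two_dvd_ne_zero.mp P.not_dvd_index))

end Burnside

end Summit.HodgeConjecture.CorCM.Census.SylowTransfer
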